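import Summits.Ventures.LatticeQCDFlow.Exactness.Phi4MetropolisPolyObs
import Summits.Ventures.LatticeQCDFlow.Exactness.Phi4MetropolisWindowComparison
import HarnessLib

/-!
# The mean energy change of the single-site Metropolis proposal of lattice φ⁴, in closed form:
# `⟨ΔS_x⟩ = m₂ (J_xx + 6λ⟨φ_x²⟩) + λ m₄` (`m_k = ∫ uᵏ ρ(u) du`)

HONEST FRAMING: exact (Metropolis-corrected) sampling algorithms for lattice gauge theory;
figures of merit are autocorrelation/cost numbers at stated couplings and volumes; no
continuum-physics claim.  (SCALAR calibration rung S0-A: not a gauge result.)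

Venture `LatticeQCDFlow` (cell pub-lqcd), topic `Exactness`; FANOUT row 2 (`s0-phi4`, LOCAL arm: the
single-site random-walk Metropolis comparator `metroSite J λ ρ x` of `Phi4LocalMetropolisExact`).
NEW WORK of the cell (the single-site restriction `latticePhi4Action_update`, evenness of the step
law, one Fubini; nothing is cited as a fact; no definition).  The acceptance floors of this
generation for the local arm (`Phi4MetropolisSiteInvolution`: Bretagnolle–Huber
`⟨a_x⟩ ≥ 1 − √(1 − e^{−⟨ΔS_x⟩})`; its Pinsker companion `≥ 1 − √(⟨ΔS_x⟩/2)`) take the first moment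
`⟨ΔS_x⟩ = Z⁻¹ ∫∫ (S(φ + u e_x) − S(φ)) ρ(u) e^{−S(φ)} du dφ` of the proposed energy change as their
only input and its integrability as their only hypothesis.  This file DISCHARGES the hypothesis for
every step law with moments and COMPUTES the input: for `S = Σ φJφ + λ Σ φ⁴` (any real `J`, `λ > 0`)
and an even step density `ρ` (`∫ ρ = 1`, all moments — the window `U[−δ, δ]`, Gaussian steps, …),

  `S(φ + u e_x) − S(φ) = F_x(φ) u + (6λ φ_x² + J_xx) u² + 4λ φ_x u³ + λ u⁴`
  (`F_x = ∂S/∂φ_x` the site force), the odd powers average out under `ρ`, and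

  **`∫∫ ΔS_x ρ e^{−S} = m₂ · (J_xx Z + 6λ ∫ φ_x² e^{−S}) + λ m₄ Z`**, i.e.
  **`⟨ΔS_x⟩ = m₂ (J_xx + 6λ ⟨φ_x²⟩) + λ m₄`**, `m₂ = ∫ u² ρ`, `m₄ = ∫ u⁴ ρ`.

Reading for S0-A (no numerics implied): the local arm's mean proposed energy change is QUADRATIC in
the step width (`m₂ = δ²/3`, `m₄ = δ⁴/5` for the window; `m₂ = s`, `m₄ = 3s²` for Gaussian steps of
variance `s`) with the two Gibbs numbers `J_xx` (`= 2d + m²` in the engine's hopping convention,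
`shiftCoupling_diag`) and `⟨φ_x²⟩`; fed into the floors above it bounds the site acceptance from
below by `1 − √(m₂(J_xx + 6λ⟨φ_x²⟩) + λm₄)` — the certified small-step side of the step-size
trade-off whose large-step side is `Phi4MetropolisWindowComparison`.

## What is proved (`Λ = Fin (n+1)`)

* `add_single_eq_update` — `φ + u e_x = (φ with φ_x := φ_x + u)`;
* **`deltaS_site_expand`** — the quartic polynomial in `u` displayed above (every real `J`, `λ`);
* `integrable_pow_mul_of_moments` (odd moments vanish inline: Lebesgue measure is reflection invariant);
* **`integral_deltaS_site_step`** — for even `ρ` with `uᵏρ ∈ L¹` (`k ≤ 4`):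
  `∫ ΔS_x(u, φ) ρ(u) du = (6λ φ_x² + J_xx) m₂ + λ m₄` at every configuration `φ`;
* **`integrable_deltaS_site`** — `λ > 0`, `ρ ≥ 0` measurable with all moments:
  `ΔS_x · (e^{−S} ρ) ∈ L¹(du dφ)` (exactly the hypothesis of `metropolisSite_acceptance_ge`);
* **`integral_deltaS_site_eq`** — the closed form for `∫∫ ΔS_x ρ e^{−S}`;
  **`meanDeltaS_site_eq`** — `(∫∫ ΔS_x ρ e^{−S})/Z = m₂ (J_xx + 6λ ⟨φ_x²⟩) + λ m₄`
  (`⟨·⟩ = gibbsExpect J λ`).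

* §4 the WINDOW `U[−δ, δ]`: `integral_pow_mul_uniformWindow`, `secondMoment_uniformWindow` (`δ²/3`),
  `fourthMoment_uniformWindow` (`δ⁴/5`), **`meanDeltaS_site_window`** —
  `⟨ΔS_x⟩ = (δ²/3)(J_xx + 6λ⟨φ_x²⟩) + λδ⁴/5`.

NOT CLAIMED: any value of `⟨φ_x²⟩` or of the acceptance for any run; the site-dependence of
`⟨φ_x²⟩` (translation invariance is not assumed); higher moments of `ΔS_x`; the flow / HMC arms.
-/

namespace Summit.Ventures.LatticeQCDFlow.Exactness

open Real MeasureTheory Filter Finset Set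
open Summit.Ventures.LatticeQCDFlow.Scoring

variable {n : ℕ}

/-! ## §1 The proposed energy change is a quartic in the step -/

/-- `φ + u e_x` is the configuration `φ` with site `x` updated to `φ_x + u`. -/
theorem add_single_eq_update (φ : Fin (n + 1) → ℝ) (x : Fin (n + 1)) (u : ℝ) :
    φ + Pi.single x u = Function.update φ x (φ x + u) := by
  funext y
  by_cases h : y = x
  · subst h
    simp
  · simp [Function.update_of_ne h, Pi.single_eq_of_ne h]

/-- **`S(φ + u e_x) − S(φ) = F_x(φ) u + (6λ φ_x² + J_xx) u² + 4λ φ_x u³ + λ u⁴`** with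
`F_x(φ) = 4λ φ_x³ + 2 J_xx φ_x + Σ_y (J_xy + J_yx) ψ_y`, `ψ = (φ with φ_x := 0)` (the site force,
`latticePhi4Force_eq`) — from the single-site restriction `latticePhi4Action_update`. -/
theorem deltaS_site_expand (J : Fin (n + 1) → Fin (n + 1) → ℝ) (lam : ℝ) (φ : Fin (n + 1) → ℝ)
    (x : Fin (n + 1)) (u : ℝ) :
    latticePhi4Action J lam (φ + Pi.single x u) - latticePhi4Action J lam φ
      = (4 * lam * φ x ^ 3 + 2 * J x x * φ x + ∑ y, (J x y + J y x) * Function.update φ x 0 y) * u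
        + (6 * lam * φ x ^ 2 + J x x) * u ^ 2 + 4 * lam * φ x * u ^ 3 + lam * u ^ 4 := by
  have h0 := latticePhi4Action_update J lam φ x (φ x)
  rw [Function.update_eq_self] at h0
  rw [add_single_eq_update, latticePhi4Action_update, h0]
  ring

/-! ## §2 The step average: odd powers drop out -/

/-- Moments from the tree's all-moments hypothesis: `(1 + |u|)ʲ ρ ∈ L¹ ⇒ uᵏ ρ ∈ L¹`. -/
theorem integrable_pow_mul_of_moments {ρ : ℝ → ℝ} (hρ0 : ∀ u, 0 ≤ ρ u) (hρm : Measurable ρ)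
    (hmom : ∀ j : ℕ, Integrable (fun u => (1 + |u|) ^ j * ρ u)) (k : ℕ) :
    Integrable (fun u => u ^ k * ρ u) := by
  refine (hmom k).mono' ((measurable_id.pow_const k).mul hρm).aestronglyMeasurable
    (Eventually.of_forall fun u => ?_)
  rw [Real.norm_eq_abs, abs_mul, abs_of_nonneg (hρ0 u), abs_pow]
  exact mul_le_mul_of_nonneg_right
    (pow_le_pow_left₀ (abs_nonneg u) (by linarith [abs_nonneg u]) k) (hρ0 u)

/-- **THE STEP AVERAGE OF THE ENERGY CHANGE**: `ρ` even with `u ρ, u² ρ, u³ ρ, u⁴ ρ ∈ L¹`; then at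
every configuration `φ`:
`∫ (S(φ + u e_x) − S(φ)) ρ(u) du = (6λ φ_x² + J_xx) · ∫ u² ρ + λ · ∫ u⁴ ρ`. -/
theorem integral_deltaS_site_step (J : Fin (n + 1) → Fin (n + 1) → ℝ) (lam : ℝ)
    (φ : Fin (n + 1) → ℝ) (x : Fin (n + 1)) {ρ : ℝ → ℝ} (hρs : ∀ u, ρ (-u) = ρ u)
    (h1 : Integrable (fun u => u ^ 1 * ρ u)) (h2 : Integrable (fun u => u ^ 2 * ρ u))
    (h3 : Integrable (fun u => u ^ 3 * ρ u)) (h4 : Integrable (fun u => u ^ 4 * ρ u)) :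
    ∫ u, (latticePhi4Action J lam (φ + Pi.single x u) - latticePhi4Action J lam φ) * ρ u
      = (6 * lam * φ x ^ 2 + J x x) * (∫ u, u ^ 2 * ρ u) + lam * ∫ u, u ^ 4 * ρ u := by
  set c1 : ℝ := 4 * lam * φ x ^ 3 + 2 * J x x * φ x + ∑ y, (J x y + J y x) * Function.update φ x 0 y
    with hc1
  set c2 : ℝ := 6 * lam * φ x ^ 2 + J x x with hc2
  set c3 : ℝ := 4 * lam * φ x with hc3
  have e : (fun u => (latticePhi4Action J lam (φ + Pi.single x u) - latticePhi4Action J lam φ) * ρ u)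
      = fun u => (c1 * (u ^ 1 * ρ u) + c2 * (u ^ 2 * ρ u)) + (c3 * (u ^ 3 * ρ u) + lam * (u ^ 4 * ρ u)) := by
    funext u
    rw [deltaS_site_expand]
    ring
  -- odd moments vanish (Lebesgue measure is reflection invariant)
  have hodd : ∀ f : ℝ → ℝ, (∀ u, f (-u) = -f u) → ∫ u, f u = 0 := fun f hf => by
    have h := integral_neg_eq_self f volume
    simp_rw [hf, integral_neg] at h
    linarith
  have ho1 : ∫ u, u ^ 1 * ρ u = 0 := hodd _ fun u => by rw [hρs]; ring
  have ho3 : ∫ u, u ^ 3 * ρ u = 0 := hodd _ fun u => by rw [hρs]; ring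
  have i12 : Integrable (fun u => c1 * (u ^ 1 * ρ u) + c2 * (u ^ 2 * ρ u)) :=
    (h1.const_mul c1).add (h2.const_mul c2)
  have i34 : Integrable (fun u => c3 * (u ^ 3 * ρ u) + lam * (u ^ 4 * ρ u)) :=
    (h3.const_mul c3).add (h4.const_mul lam)
  rw [e, integral_add i12 i34, integral_add (h1.const_mul c1) (h2.const_mul c2),
    integral_add (h3.const_mul c3) (h4.const_mul lam),
    integral_const_mul, integral_const_mul, integral_const_mul, integral_const_mul, ho1, ho3]
  ring

/-! ## §3 Integrability on `ℝ × ℝ^Λ` and the Gibbs average -/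

/-- **`ΔS_x · (e^{−S} ρ) ∈ L¹(du dφ)`** for `λ > 0`, any real `J`, and any step density `ρ ≥ 0`
with all moments — the hypothesis `hΔ` of the site-Metropolis acceptance floors, discharged.
Domination: `|S(φ')| ≤ B env(φ')ᵏ` (`polyObs_action`) and `env(φ + u e_x) ≤ (1 + |u|)² env(φ)`
(`env_update_le`). -/
theorem integrable_deltaS_site {lam : ℝ} (hlam : 0 < lam) (J : Fin (n + 1) → Fin (n + 1) → ℝ)
    {ρ : ℝ → ℝ} (hρ0 : ∀ u, 0 ≤ ρ u) (hρm : Measurable ρ)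
    (hmom : ∀ j : ℕ, Integrable (fun u => (1 + |u|) ^ j * ρ u)) (x : Fin (n + 1)) :
    Integrable (fun p : ℝ × (Fin (n + 1) → ℝ) =>
      (latticePhi4Action J lam (p.2 + Pi.single x p.1) - latticePhi4Action J lam p.2)
        * (gibbsWeight J lam p.2 * ρ p.1))
      ((volume : Measure ℝ).prod (volume : Measure (Fin (n + 1) → ℝ))) := by
  obtain ⟨hSm, B, k, hB⟩ := polyObs_action J lam
  have hco := latticePhi4Action_coercive hlam J
  have henv : Integrable (fun φ : Fin (n + 1) → ℝ => (1 + ∑ w, φ w ^ 2) ^ k * gibbsWeight J lam φ) :=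
    integrable_env_pow_mul_gibbsWeight one_pos hco k
  have hρi : Integrable ρ := by simpa using hmom 0
  -- dominating product function
  have hU : Integrable (fun u : ℝ => |B| * (((1 + |u|) ^ (2 * k) + 1) * ρ u)) := by
    have h : Integrable (fun u : ℝ => (1 + |u|) ^ (2 * k) * ρ u + ρ u) := (hmom (2 * k)).add hρi
    exact (h.const_mul |B|).congr (Eventually.of_forall fun u => by ring)
  have hdom := hU.mul_prod henv
  -- measurability of the integrand
  have hsingle : Measurable fun u : ℝ => (Pi.single x u : Fin (n + 1) → ℝ) := by
    refine measurable_pi_iff.2 fun y => ?_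
    by_cases h : y = x
    · subst h
      simp only [Pi.single_eq_same]
      exact measurable_id
    · simp only [Pi.single_eq_of_ne h]
      exact measurable_const
  have hshift : Measurable fun p : ℝ × (Fin (n + 1) → ℝ) => p.2 + Pi.single x p.1 :=
    measurable_snd.add (hsingle.comp measurable_fst)
  have hwm : Measurable (gibbsWeight J lam) := (continuous_gibbsWeight J lam).measurable
  have hFm : Measurable fun p : ℝ × (Fin (n + 1) → ℝ) =>
      (latticePhi4Action J lam (p.2 + Pi.single x p.1) - latticePhi4Action J lam p.2)
        * (gibbsWeight J lam p.2 * ρ p.1) :=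
    ((hSm.comp hshift).sub (hSm.comp measurable_snd)).mul
      ((hwm.comp measurable_snd).mul (hρm.comp measurable_fst))
  refine hdom.mono' hFm.aestronglyMeasurable (Eventually.of_forall fun p => ?_)
  obtain ⟨u, φ⟩ := p
  dsimp only
  have henv1 : 1 ≤ 1 + ∑ w, φ w ^ 2 := one_le_env φ
  have henvk : 0 ≤ (1 + ∑ w, φ w ^ 2) ^ k := pow_nonneg (by linarith) k
  have hw0 : 0 < gibbsWeight J lam φ := gibbsWeight_pos J lam φ
  -- the moved envelope
  set φ' : Fin (n + 1) → ℝ := φ + Pi.single x u with hφ'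
  have hmove : (1 + ∑ w, φ' w ^ 2) ^ k ≤ (1 + |u|) ^ (2 * k) * (1 + ∑ w, φ w ^ 2) ^ k := by
    have h := env_update_le φ x (φ x + u)
    rw [← add_single_eq_update, show φ x + u - φ x = u by ring] at h
    calc (1 + ∑ w, φ' w ^ 2) ^ k
        ≤ ((1 + |u|) ^ 2 * (1 + ∑ w, φ w ^ 2)) ^ k :=
          pow_le_pow_left₀ (by linarith [one_le_env φ']) h k
      _ = (1 + |u|) ^ (2 * k) * (1 + ∑ w, φ w ^ 2) ^ k := by rw [mul_pow, ← pow_mul]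
  have hS1 : |latticePhi4Action J lam φ'| ≤ |B| * ((1 + |u|) ^ (2 * k) * (1 + ∑ w, φ w ^ 2) ^ k) :=
    (abs_le_abs_mul_env hB φ').trans (mul_le_mul_of_nonneg_left hmove (abs_nonneg B))
  have hS0 : |latticePhi4Action J lam φ| ≤ |B| * (1 + ∑ w, φ w ^ 2) ^ k := abs_le_abs_mul_env hB φ
  rw [Real.norm_eq_abs, abs_mul, abs_mul, abs_of_pos hw0, abs_of_nonneg (hρ0 u)]
  have hΔ : |latticePhi4Action J lam φ' - latticePhi4Action J lam φ|
      ≤ |B| * (((1 + |u|) ^ (2 * k) + 1) * (1 + ∑ w, φ w ^ 2) ^ k) := by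
    have h := (abs_sub (latticePhi4Action J lam φ') (latticePhi4Action J lam φ)).trans
      (add_le_add hS1 hS0)
    linarith [h]
  calc |latticePhi4Action J lam φ' - latticePhi4Action J lam φ|
        * (gibbsWeight J lam φ * ρ u)
      ≤ |B| * (((1 + |u|) ^ (2 * k) + 1) * (1 + ∑ w, φ w ^ 2) ^ k) * (gibbsWeight J lam φ * ρ u) :=
        mul_le_mul_of_nonneg_right hΔ (mul_nonneg hw0.le (hρ0 u))
    _ = |B| * (((1 + |u|) ^ (2 * k) + 1) * ρ u) * ((1 + ∑ w, φ w ^ 2) ^ k * gibbsWeight J lam φ) := by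
        ring

/-- `φ_x² e^{−S} ∈ L¹` (`λ > 0`): `φ_x² ≤ env(φ)`. -/
theorem integrable_sq_site_mul_gibbsWeight {lam : ℝ} (hlam : 0 < lam)
    (J : Fin (n + 1) → Fin (n + 1) → ℝ) (x : Fin (n + 1)) :
    Integrable (fun φ : Fin (n + 1) → ℝ => φ x ^ 2 * gibbsWeight J lam φ) := by
  have hco := latticePhi4Action_coercive hlam J
  have henv := integrable_env_pow_mul_gibbsWeight one_pos hco 1
  refine henv.mono' (((measurable_pi_apply x).pow_const 2).mul
    (continuous_gibbsWeight J lam).measurable).aestronglyMeasurable (Eventually.of_forall fun φ => ?_)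
  have hw0 : 0 < gibbsWeight J lam φ := gibbsWeight_pos J lam φ
  rw [Real.norm_eq_abs, abs_mul, abs_of_nonneg (sq_nonneg _), abs_of_pos hw0, pow_one]
  refine mul_le_mul_of_nonneg_right ?_ hw0.le
  have h : φ x ^ 2 ≤ ∑ w, φ w ^ 2 := Finset.single_le_sum (fun w _ => sq_nonneg (φ w)) (Finset.mem_univ x)
  linarith

/-- **THE MEAN ENERGY CHANGE OF THE SITE PROPOSAL, CLOSED FORM**: `λ > 0`, real `J`, `ρ ≥ 0` even
measurable with all moments (`(1+|u|)ʲρ ∈ L¹`; no normalisation needed); then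
`∫∫ (S(φ + u e_x) − S(φ)) e^{−S(φ)} ρ(u) du dφ = (∫u²ρ)·(J_xx Z + 6λ ∫ φ_x² e^{−S}) + λ (∫u⁴ρ) Z`. -/
theorem integral_deltaS_site_eq {lam : ℝ} (hlam : 0 < lam) (J : Fin (n + 1) → Fin (n + 1) → ℝ)
    {ρ : ℝ → ℝ} (hρ0 : ∀ u, 0 ≤ ρ u) (hρm : Measurable ρ) (hρs : ∀ u, ρ (-u) = ρ u)
    (hmom : ∀ j : ℕ, Integrable (fun u => (1 + |u|) ^ j * ρ u)) (x : Fin (n + 1)) :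
    ∫ p, (latticePhi4Action J lam (p.2 + Pi.single x p.1) - latticePhi4Action J lam p.2)
        * (gibbsWeight J lam p.2 * ρ p.1) ∂((volume : Measure ℝ).prod (volume : Measure (Fin (n + 1) → ℝ)))
      = (∫ u, u ^ 2 * ρ u) * (J x x * gibbsZ J lam + 6 * lam * ∫ φ, φ x ^ 2 * gibbsWeight J lam φ)
        + lam * (∫ u, u ^ 4 * ρ u) * gibbsZ J lam := by
  have hint := integrable_deltaS_site hlam J hρ0 hρm hmom x
  have hk := integrable_pow_mul_of_moments hρ0 hρm hmom
  rw [integral_prod_symm _ hint]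
  -- the inner `u`-integral at fixed `φ`
  have inner : ∀ φ : Fin (n + 1) → ℝ,
      ∫ u, (latticePhi4Action J lam (φ + Pi.single x u) - latticePhi4Action J lam φ)
          * (gibbsWeight J lam φ * ρ u)
        = gibbsWeight J lam φ * ((6 * lam * φ x ^ 2 + J x x) * (∫ u, u ^ 2 * ρ u)
            + lam * ∫ u, u ^ 4 * ρ u) := by
    intro φ
    rw [← integral_deltaS_site_step J lam φ x hρs (hk 1) (hk 2) (hk 3) (hk 4), ← integral_const_mul]
    exact integral_congr_ae (Eventually.of_forall fun u => by ring)
  have e1 : (fun φ : Fin (n + 1) → ℝ => ∫ u, (latticePhi4Action J lam ((u, φ).2 + Pi.single x (u, φ).1)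
      - latticePhi4Action J lam (u, φ).2) * (gibbsWeight J lam (u, φ).2 * ρ (u, φ).1))
      = fun φ => (∫ u, u ^ 2 * ρ u) * (J x x * gibbsWeight J lam φ + 6 * lam * (φ x ^ 2 * gibbsWeight J lam φ))
          + lam * (∫ u, u ^ 4 * ρ u) * gibbsWeight J lam φ := by
    funext φ
    simp only []
    rw [inner φ]
    ring
  rw [e1]
  have hw := integrable_gibbsWeight hlam J
  have hsq := integrable_sq_site_mul_gibbsWeight hlam J x
  have hA : Integrable (fun φ : Fin (n + 1) → ℝ =>
      J x x * gibbsWeight J lam φ + 6 * lam * (φ x ^ 2 * gibbsWeight J lam φ)) :=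
    (hw.const_mul _).add (hsq.const_mul _)
  rw [integral_add (hA.const_mul _) (hw.const_mul _), integral_const_mul, integral_const_mul,
    integral_add (hw.const_mul _) (hsq.const_mul _), integral_const_mul, integral_const_mul]
  rfl

/-- **`⟨ΔS_x⟩ = m₂ (J_xx + 6λ ⟨φ_x²⟩) + λ m₄`** (`⟨·⟩ = gibbsExpect J λ`, `m_k = ∫ uᵏ ρ`): the Gibbs
mean of the proposed energy change of the single-site Metropolis update with an even step law. -/
theorem meanDeltaS_site_eq {lam : ℝ} (hlam : 0 < lam) (J : Fin (n + 1) → Fin (n + 1) → ℝ)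
    {ρ : ℝ → ℝ} (hρ0 : ∀ u, 0 ≤ ρ u) (hρm : Measurable ρ) (hρs : ∀ u, ρ (-u) = ρ u)
    (hmom : ∀ j : ℕ, Integrable (fun u => (1 + |u|) ^ j * ρ u)) (x : Fin (n + 1)) :
    (∫ p, (latticePhi4Action J lam (p.2 + Pi.single x p.1) - latticePhi4Action J lam p.2)
        * (gibbsWeight J lam p.2 * ρ p.1) ∂((volume : Measure ℝ).prod (volume : Measure (Fin (n + 1) → ℝ))))
        / gibbsZ J lam
      = (∫ u, u ^ 2 * ρ u) * (J x x + 6 * lam * gibbsExpect J lam (fun φ => φ x ^ 2))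
        + lam * ∫ u, u ^ 4 * ρ u := by
  rw [integral_deltaS_site_eq hlam J hρ0 hρm hρs hmom x]
  have hZ := gibbsZ_pos hlam J
  unfold gibbsExpect
  field_simp

/-! ## §4 The window step law `U[−δ, δ]`: `m₂ = δ²/3`, `m₄ = δ⁴/5` -/

/-- Moments of the window: `∫ uᵏ · 1_{[−δ,δ]}(u)/(2δ) du = (δ^{k+1} − (−δ)^{k+1})/((k+1)·2δ)`. -/
theorem integral_pow_mul_uniformWindow {δ : ℝ} (hδ : 0 < δ) (k : ℕ) :
    ∫ u, u ^ k * (Icc (-δ) δ).indicator (fun _ : ℝ => (2 * δ)⁻¹) u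
      = (δ ^ (k + 1) - (-δ) ^ (k + 1)) / (k + 1) * (2 * δ)⁻¹ := by
  have e : (fun u : ℝ => u ^ k * (Icc (-δ) δ).indicator (fun _ : ℝ => (2 * δ)⁻¹) u)
      = (Icc (-δ) δ).indicator (fun u : ℝ => u ^ k * (2 * δ)⁻¹) :=
    funext fun u => (Set.indicator_mul_right _ (fun u : ℝ => u ^ k) _).symm
  rw [e, integral_indicator measurableSet_Icc, integral_Icc_eq_integral_Ioc,
    ← intervalIntegral.integral_of_le (by linarith : -δ ≤ δ), intervalIntegral.integral_mul_const,
    integral_pow]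

/-- `m₂ = δ²/3` for the window. -/
theorem secondMoment_uniformWindow {δ : ℝ} (hδ : 0 < δ) :
    ∫ u, u ^ 2 * (Icc (-δ) δ).indicator (fun _ : ℝ => (2 * δ)⁻¹) u = δ ^ 2 / 3 := by
  rw [integral_pow_mul_uniformWindow hδ 2]
  have hδ0 : δ ≠ 0 := hδ.ne'
  field_simp
  ring

/-- `m₄ = δ⁴/5` for the window. -/
theorem fourthMoment_uniformWindow {δ : ℝ} (hδ : 0 < δ) :
    ∫ u, u ^ 4 * (Icc (-δ) δ).indicator (fun _ : ℝ => (2 * δ)⁻¹) u = δ ^ 4 / 5 := by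
  rw [integral_pow_mul_uniformWindow hδ 4]
  have hδ0 : δ ≠ 0 := hδ.ne'
  field_simp
  ring

/-- **THE WINDOW INSTANCE**: for the single-site Metropolis update of lattice φ⁴ with the uniform
window `U[−δ, δ]` (`δ > 0`; every `λ > 0`, real `J`, site `x`):
`⟨ΔS_x⟩ = (δ²/3)·(J_xx + 6λ ⟨φ_x²⟩) + λ δ⁴/5` — quadratic in the window at small `δ`. -/
theorem meanDeltaS_site_window {lam : ℝ} (hlam : 0 < lam) (J : Fin (n + 1) → Fin (n + 1) → ℝ)
    {δ : ℝ} (hδ : 0 < δ) (x : Fin (n + 1)) :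
    (∫ p, (latticePhi4Action J lam (p.2 + Pi.single x p.1) - latticePhi4Action J lam p.2)
        * (gibbsWeight J lam p.2 * (Icc (-δ) δ).indicator (fun _ : ℝ => (2 * δ)⁻¹) p.1)
          ∂((volume : Measure ℝ).prod (volume : Measure (Fin (n + 1) → ℝ))))
        / gibbsZ J lam
      = δ ^ 2 / 3 * (J x x + 6 * lam * gibbsExpect J lam (fun φ => φ x ^ 2)) + lam * (δ ^ 4 / 5) := by
  rw [meanDeltaS_site_eq hlam J (uniformWindow_nonneg δ hδ) (uniformWindow_measurable δ)
    (uniformWindow_even δ) (uniformWindow_moments hδ) x, secondMoment_uniformWindow hδ,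
    fourthMoment_uniformWindow hδ]

end Summit.Ventures.LatticeQCDFlow.Exactness
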